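import Literature.MathematicalPhysics.QuantumFieldTheory.Balaban1983to89.B9Eq349ConjugatedProjectionDifferenceLettersTwoBackgrounds
import Literature.MathematicalPhysics.QuantumFieldTheory.Balaban1983to89.B9Eq349ConjugatedQprimeTowerTwoBackgrounds
import Literature.MathematicalPhysics.QuantumFieldTheory.Balaban1983to89.B9Eq349ConjugatedDPChainTower
import Literature.MathematicalPhysics.QuantumFieldTheory.Balaban1983to89.B9Eq349ConjugatedQGGQInvLetters
import Literature.MathematicalPhysics.QuantumFieldTheory.Balaban1983to89.B9Eq3101ConjugationLettersTwoBackgroundsAdjoint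
import Literature.MathematicalPhysics.QuantumFieldTheory.Balaban1983to89.B9Eq3101ExpPointwiseMultiplier

/-!
# `Balaban1983to89.B9Eq349ConjugatedProjectionDifferenceTowerTwoBackgrounds` — T. Bałaban, *Propagators for lattice gauge theories in a background field*,
# Commun. Math. Phys. **99** (1985) 389–434 [Balaban1985BackgroundPropagators] (3.21)∕(3.25) p. 394 (with (3.16)∕(3.19)∕(3.24) pp. 393–394), (3.49) p. 399,
# Thm 3.11 p. 416: **THE CONJUGATED TWO-BACKGROUND LETTER `δ_R` OF THE PROJECTION `R_k` AT THE TOWER — `‖S R_k(V) S⁻¹ x − S R_k(U) S⁻¹ x‖ ≤ ρ₂(κ)·‖x‖`,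
# `ρ₂` LINEAR in the bond closeness `δ` of the two backgrounds and in their level averages' closeness `δ_j`, every height `n`** — the word
# `S(1 − R_k(X))S⁻¹ = G_κ(X)Q′_κ(X)c_κ(X)Q_κ(X)G_κ(X)` at `X = U, V` ((3.25) `1 − R = G′Q̃′†(Q̃′G′²Q̃′†)⁻¹Q̃′G′`, ne9-leaf-06∕-03's
# `B9Eq349ConjugatedProjectionChainTower.one_sub_RofUk_apply_eq`, conjugated factor by factor), I-10's abstract word difference
# `B9Eq349ConjugatedProjectionDifferenceLettersTwoBackgrounds.norm_Pk_sub_Pk_le` with EVERY letter discharged at the tower: the two conjugated families =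
# ne9-leaf-03's `B9Eq349ConjugatedDPChainLettersTower` §2 (`conjHk_plus_apply`, `conjHk_plus_conjGk`, `conjGk_plus_conjHk`) at `U` and at `V` with the (I4) letters
# of `B9Eq349ConjugatedDPChainLetters(Tower)`, the conjugated Gram bound `C_c = 2∕κ₁` = `B9Eq349ConjugatedQGGQInvLetters.norm_ck_le` ×2, the two-background
# letters `b_D = b_{D′} = 2e^{‖κ‖ℓη}M_φM_φ′√d·δ` = this lineage's gen-88 `B9Eq3101ConjugationLettersTwoBackgroundsAdjoint.norm_mulOp_covDerivL2K_sub_covDerivL2K_le`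
# (at `κ` and, through the adjoints' pointwise action and the pairing, at the `D′` side), `b_Q = b_{Q′} = e^{‖κ‖ℓ′}·δ_{Q′}` = I-8; §2 reads the letter in the
# `exp(κ•M_S)` currency of I-5∕I-7's displayed binder `hTR` (every `‖κ‖ = r`)

statement-level skeleton of published theorems with citation tags; proofs where landed; nothing here is a claim about the Yang–Mills mass gap

PDF held: `paper:balaban1985-cmp99-background-propagators` (journal page = PDF page + 388); pp. 393–394, 399, 416 read.

CITATION HEADER (lean-in-tree rule 2026-08-18).  Audit cell `pub-balaban`, sub-cell `t4`, NE9 crux team (2): LEAF PROVER 01 (`b2b-balaban-t4-ne9-formalise-leaf-01`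
gen 90), I-11 = the FOURTH brick of `δ_R` (ne9-leaf-04 g81's located plan (M+) «the (PDC) chain run on DIFFERENCES»): the TOWER INSTANCE.  TEMPLATES
CREDITED: ne9-leaf-03's `B9Eq349ConjugatedDPChainTower.norm_Akp_sub_Ak_le` (the family discharge at the tower, verbatim ×2) and
`B9Eq349ConjugatedProjectionDifferenceChainTower` (statement shape), the OWNER g94's `B9Eq326DeltaAHQKLettersTower` §1 (the `exp(κ•M)` reading).

WHAT IS PROVED (sorry-free; 0 `def`; [folklore] composition BY NAME; nothing of [B9] asserted as printed).
* §1 (abstract multipliers `S, S⁻¹, S_B, S_B⁻¹, S_G, S_G⁻¹` acting pointwise as `e^{±κχ}`, `e^{±κχ(b₋)}`, `e^{±κχ′}`): `norm_conjD_sub_conjD_le` (`b_D`),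
  `norm_conjDm_sub_conjDm_le` (at `−κ̄`), `norm_conjD'_sub_conjD'_le` (`b_{D′}`, through the pairing), `conj_RofUk_eq_sub_word` (`S R_k(X) S⁻¹ x = x − word_κ(X)x`),
  **`norm_conjRofUk_sub_conjRofUk_le`** — `‖S(R_k(V)(S⁻¹x)) − S(R_k(U)(S⁻¹x))‖ ≤ ρ₂·‖x‖`, `ρ₂ = σC_cn + n(C_c(σn + nσ)C_c)n + nC_cσ`, `n = (4∕γ′)(M+1)`,
  `C_c = 2∕κ₁`, `σ = (4∕γ′)b_Q + b_Q(4∕γ′) + 2(M+1)(4∕γ′)²(2b_D + (1+β′)b_D + a′(M+1)(b_Q + b_Q))`.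
* §2 **`norm_expConj_RofUk_sub_expConj_RofUk_le`** — the same in I-5∕I-7's `hTR` shape: for every fine weight `χ` (increments `≤ ℓη`), big-block companion `χ′`
  (`≤ ℓ′`), multipliers `M_B, M_S, M_F` and `‖κ‖ = r`.
DISPLAYED (per height, as in the one-background `dR`): `γ′`-coercivity of `D*D + a′Q̃′†Q̃′` at `U` and at `V`, `hpos′`, the `κ₁`-floor of `Q̃′G′²Q̃′†` at `U` and
at `V`, `‖Q̃′_k‖ ≤ M` at both, the windows `rℓη ≤ 1`, `rℓ′ ≤ 1`, `2rℓM_φM_φ′√d ≤ β′`, `2rℓ′M ≤ β′`, `3(1+a′)β′² ≤ γ′∕4`, and the NEW Gram window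
`β′·s_A·(4∕γ′)(2M+1) ≤ κ₁∕2` (`s_A = 4∕γ′ + M(4∕γ′)²(3 + a′(2M+1))`); the MODEL letters (bond closeness `δη`, level averages `U1`-valued, `ε_j`-small, `δ_j`-close).
HONEST SCOPE.  [folklore]; `ρ₂ = O(δ + max_j δ_j)` at fixed letters but no rate ∕ window solved ∕ number evaluated; KAPPA1 load-bearing; NOT NE9; «NE9 ⇐ the
named binders»; NE9 NOT PRINTED ∕ NOT PROVED; NOT summit progress (cell pub-balaban: row NE9 WALLED ON A MODEL (O-NE9-1; #5 UNRULED); spine PROVED 0∕9; rung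
(B)+1 finite T⁴ — NOT infinite volume, NOT mass gap, NOT BetaPertH, NOT Clay; HONEST DEPENDENCY: continuum YM on T⁴ ⇐ BetaPertH ∧ nine spine estimates (0/9
proved); BetaPertH ⇐ (D1) ∧ (D4) ∧ CAP+tail; G-an2-4 gates asym, D1 and NE2/3/4).  NEW file; nothing modified.  Net new unproved facts: 0.
-/

noncomputable section

set_option autoImplicit false

open scoped InnerProductSpace ComplexConjugate
open NormedSpace

namespace Literature.MathematicalPhysics.QuantumFieldTheory.Balaban1983to89.B9Eq349ConjugatedProjectionDifferenceTowerTwoBackgrounds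

open B4Sect5Torus (TSite)
open B9SectCLatticeCarrier (Bond bpos btgt)
open B9Eq311L2Pairing (WL2)
open B11Eq103H1Complex (SiteL2K BondL2K greenK covDerivL2K apply_greenK greenK_apply)
open B7Prop1Explicit (U1)
open B9Eq310HessianOperator (adTransportW)
open B9Eq315QTower (towerP UlevOf)
open B9Eq316TowerFlatIsOneStep (siteCast towerP_eq_fineP_pow)
open B9Eq319QprimeTorus (blockCoord mem_blockOf_iff)
open B9Eq326OperatorTower (QprimeTowerW RofUk)
open B9Eq324DeltaPrimeATower (laplacePrimeAk GpOfUk)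
open B9Eq325ProjFormulaTower (QGGQk_pos)
open B9Eq349ConjugatedProjectionChainTower (one_sub_RofUk_apply_eq)
open B9Eq349ConjugatedDPChainLetters (SGinv_SG SG_SGinv norm_Dp_sub_le norm_Dp'_sub_le)
open B9Eq349ConjugatedDPChainLettersTower (S_Sinv Sinv_S norm_QpTower_sub_le norm_QpTower'_sub_le laplacePrimeAk_apply_eq
  laplacePrimeAk_GpOfUk_apply conjHk_plus_apply conjHk_plus_conjGk conjGk_plus_conjHk)
open B9Eq349ConjugatedQGGQInvLetters (norm_ck_le)
open B9Eq3101ConjugationLettersTwoBackgroundsAdjoint (norm_mulOp_covDerivL2K_sub_covDerivL2K_le)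
open B9Eq368RLipschitzTwoBackgrounds (norm_adTransportW_sub_adTransportW_le)
open B9Eq349ConjugatedQprimeTowerTwoBackgrounds (norm_QpTower_sub_QpTower_le_of_levels norm_QpTower'_sub_QpTower'_le_of_levels)
open B9Eq349ConjugatedProjectionDifferenceLettersTwoBackgrounds (norm_Pk_sub_Pk_le)
open B9Eq3101ExpPointwiseMultiplier (equiv_exp_smul_apply_complex equiv_exp_smul_neg_apply_complex)

/-! ## §1 At abstract multipliers -/

section Letters

variable {d : ℕ} {L : ℕ} [NeZero L] {m : Fin d → ℕ} [∀ i, NeZero (m i)] {n : ℕ}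
  {𝔸 : Type*} [NormedRing 𝔸] [NormedAlgebra ℂ 𝔸] [CompleteSpace 𝔸] [NormOneClass 𝔸]
  {W : Type*} [NormedAddCommGroup W] [InnerProductSpace ℂ W] [FiniteDimensional ℂ W] {φ : W ≃ₗ[ℂ] 𝔸} {Mφ Mφ' : ℝ}
  (hφ : ∀ w, ‖φ w‖ ≤ Mφ * ‖w‖) (hφ' : ∀ X, ‖φ.symm X‖ ≤ Mφ' * ‖X‖) (hMφ : 0 ≤ Mφ) (hMφ' : 0 ≤ Mφ')
  {c₀ : ℝ} [Fact (0 < c₀)] {η : ℝ} (hη : 0 < η) {U V : Bond d (towerP L m (n + 1)) → 𝔸ˣ} (hU : ∀ b, U b ∈ U1 𝔸) (hV : ∀ b, V b ∈ U1 𝔸)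
  {c₁ : ℝ} [Fact (0 < c₁)] {a' : ℝ} (ha' : 0 ≤ a')
  (hRSU : ∀ (b : Bond d (towerP L m (n + 1))) (v u : W), ⟪adTransportW φ U b v, u⟫_ℂ = ⟪v, adTransportW φ (fun b => (U b)⁻¹) b u⟫_ℂ)
  (hRSV : ∀ (b : Bond d (towerP L m (n + 1))) (v u : W), ⟪adTransportW φ V b v, u⟫_ℂ = ⟪v, adTransportW φ (fun b => (V b)⁻¹) b u⟫_ℂ)
  (hpos'U : ∀ x : SiteL2K ℂ d (towerP L m (n + 1)) c₀ W, x ≠ 0 → 0 < RCLike.re ⟪x, laplacePrimeAk L m n φ η U a' (c₁ := c₁) x⟫_ℂ)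
  (hpos'V : ∀ x : SiteL2K ℂ d (towerP L m (n + 1)) c₀ W, x ≠ 0 → 0 < RCLike.re ⟪x, laplacePrimeAk L m n φ η V a' (c₁ := c₁) x⟫_ℂ)
  -- the conjugation: cut-offs and the six multipliers
  {κ : ℂ} {ℓ ℓ' : ℝ} (hℓ : 0 ≤ ℓ) (hℓ' : 0 ≤ ℓ') {χ : TSite d (towerP L m (n + 1)) → ℝ} {χ' : TSite d m → ℝ}
  (hχ : ∀ b : Bond d (towerP L m (n + 1)), |χ (bpos b) - χ (btgt b)| ≤ ℓ * η)
  (hχ' : ∀ (y : TSite d m) (x : TSite d (towerP L m (n + 1))),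
    blockCoord (L ^ (n + 1)) m (siteCast (towerP_eq_fineP_pow L m (n + 1)) x) = y → |χ' y - χ x| ≤ ℓ') (hwin : ‖κ‖ * ℓ * η ≤ 1) (hwin' : ‖κ‖ * ℓ' ≤ 1)
  {S Sinv : SiteL2K ℂ d (towerP L m (n + 1)) c₀ W →ₗ[ℂ] SiteL2K ℂ d (towerP L m (n + 1)) c₀ W}
  (hS : ∀ (f : SiteL2K ℂ d (towerP L m (n + 1)) c₀ W) (x : TSite d (towerP L m (n + 1))),
    WL2.equiv ℂ (fun _ : TSite d (towerP L m (n + 1)) => c₀) W (S f) x =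
      Complex.exp (κ * (χ x : ℂ)) • WL2.equiv ℂ (fun _ : TSite d (towerP L m (n + 1)) => c₀) W f x)
  (hSinv : ∀ (f : SiteL2K ℂ d (towerP L m (n + 1)) c₀ W) (x : TSite d (towerP L m (n + 1))),
    WL2.equiv ℂ (fun _ : TSite d (towerP L m (n + 1)) => c₀) W (Sinv f) x =
      Complex.exp (-(κ * (χ x : ℂ))) • WL2.equiv ℂ (fun _ : TSite d (towerP L m (n + 1)) => c₀) W f x)
  {SB SBinv : BondL2K ℂ d (towerP L m (n + 1)) c₀ W →ₗ[ℂ] BondL2K ℂ d (towerP L m (n + 1)) c₀ W}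
  (hSB : ∀ (g : BondL2K ℂ d (towerP L m (n + 1)) c₀ W) (b : Bond d (towerP L m (n + 1))),
    WL2.equiv ℂ (fun _ : Bond d (towerP L m (n + 1)) => c₀) W (SB g) b =
      Complex.exp (κ * (χ (bpos b) : ℂ)) • WL2.equiv ℂ (fun _ : Bond d (towerP L m (n + 1)) => c₀) W g b)
  (hSBinv : ∀ (g : BondL2K ℂ d (towerP L m (n + 1)) c₀ W) (b : Bond d (towerP L m (n + 1))),
    WL2.equiv ℂ (fun _ : Bond d (towerP L m (n + 1)) => c₀) W (SBinv g) b =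
      Complex.exp (-(κ * (χ (bpos b) : ℂ))) • WL2.equiv ℂ (fun _ : Bond d (towerP L m (n + 1)) => c₀) W g b)
  {SG SGinv : SiteL2K ℂ d m c₁ W →ₗ[ℂ] SiteL2K ℂ d m c₁ W}
  (hSG : ∀ (g : SiteL2K ℂ d m c₁ W) (y : TSite d m),
    WL2.equiv ℂ (fun _ : TSite d m => c₁) W (SG g) y = Complex.exp (κ * (χ' y : ℂ)) • WL2.equiv ℂ (fun _ : TSite d m => c₁) W g y)
  (hSGinv : ∀ (g : SiteL2K ℂ d m c₁ W) (y : TSite d m),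
    WL2.equiv ℂ (fun _ : TSite d m => c₁) W (SGinv g) y = Complex.exp (-(κ * (χ' y : ℂ))) • WL2.equiv ℂ (fun _ : TSite d m => c₁) W g y)
  -- the two backgrounds' closeness: bonds and level averages
  {δ : ℝ} (hδ : 0 ≤ δ) (hUV : ∀ b, ‖(U b : 𝔸) - (V b : 𝔸)‖ ≤ δ * η)
  (εU δUV : ℕ → ℝ) (hεU : ∀ j, 0 ≤ εU j) (hδUV : ∀ j, 0 ≤ δUV j)
  (hLεU : ∀ (j : ℕ) (b : Bond d (towerP L m (j + 1))), ‖(UlevOf L m (n + 1) U j b : 𝔸) - 1‖ ≤ εU j)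
  (hLεV : ∀ (j : ℕ) (b : Bond d (towerP L m (j + 1))), ‖(UlevOf L m (n + 1) V j b : 𝔸) - 1‖ ≤ εU j)
  (hLbU : ∀ (j : ℕ) (b : Bond d (towerP L m (j + 1))), UlevOf L m (n + 1) U j b ∈ U1 𝔸)
  (hLbV : ∀ (j : ℕ) (b : Bond d (towerP L m (j + 1))), UlevOf L m (n + 1) V j b ∈ U1 𝔸)
  (hLUV : ∀ (j : ℕ) (b : Bond d (towerP L m (j + 1))), ‖(UlevOf L m (n + 1) U j b : 𝔸) - (UlevOf L m (n + 1) V j b : 𝔸)‖ ≤ δUV j)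

omit [NeZero L] [∀ i, NeZero (m i)] [Fact (0 < c₁)] [CompleteSpace 𝔸] [FiniteDimensional ℂ W] in
include hφ hφ' hMφ hMφ' hη hU hV hχ hSB hSinv hδ hUV in
/-- **`b_D` AT THE TOWER**: `‖S_B D_V S⁻¹ s − S_B D_U S⁻¹ s‖ ≤ 2e^{‖κ‖ℓη}M_φM_φ′√d·δ·‖s‖` — gen 88's «conjugate the difference» gradient letter with the
transporters `2M_φM_φ′δη`-close (`norm_adTransportW_sub_adTransportW_le`) and `‖η⁻¹‖·δη = δ`; NO window. [folklore]
[cite: Balaban1985BackgroundPropagators, (3.3) pp.390–391, (3.49) p.399, (3.101)–(3.103) p.414] -/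
theorem norm_conjD_sub_conjD_le (s : SiteL2K ℂ d (towerP L m (n + 1)) c₀ W) :
    ‖(SB ∘ₗ covDerivL2K ℂ c₀ ((η : ℂ))⁻¹ (adTransportW φ V) ∘ₗ Sinv) s - (SB ∘ₗ covDerivL2K ℂ c₀ ((η : ℂ))⁻¹ (adTransportW φ U) ∘ₗ Sinv) s‖ ≤
      2 * Real.exp (‖κ‖ * (ℓ * η)) * (Mφ * Mφ') * Real.sqrt d * δ * ‖s‖ := by
  have hT : ∀ (b : Bond d (towerP L m (n + 1))) (v : W), ‖adTransportW φ V b v - adTransportW φ U b v‖ ≤ 2 * Mφ * Mφ' * (δ * η) * ‖v‖ :=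
    fun b v => norm_adTransportW_sub_adTransportW_le L (towerP L m n) φ hφ hφ' hMφ' V U b (hV b) (hU b)
      (by rw [norm_sub_rev]; exact hUV b) v
  have h := norm_mulOp_covDerivL2K_sub_covDerivL2K_le (c₀ := c₀) (by positivity : (0 : ℝ) ≤ 2 * Mφ * Mφ' * (δ * η)) hT hχ ((η : ℂ))⁻¹
    SB hSB Sinv hSinv s
  have hηn : ‖((η : ℂ))⁻¹‖ = η⁻¹ := by rw [norm_inv, Complex.norm_real, Real.norm_eq_abs, abs_of_pos hη]
  simp only [LinearMap.comp_apply]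
  calc _ ≤ ‖((η : ℂ))⁻¹‖ * Real.exp (‖κ‖ * (ℓ * η)) * (2 * Mφ * Mφ' * (δ * η)) * Real.sqrt d * ‖s‖ := h
    _ = 2 * Real.exp (‖κ‖ * (ℓ * η)) * (Mφ * Mφ') * Real.sqrt d * δ * ‖s‖ := by
        rw [hηn]; field_simp

omit [NeZero L] [∀ i, NeZero (m i)] [Fact (0 < c₁)] [CompleteSpace 𝔸] in
include hφ hφ' hMφ hMφ' hη hU hV hχ hS hSBinv hδ hUV in
/-- **… AT `−κ̄`**: `‖(S_B⁻¹)† D_V S† f − (S_B⁻¹)† D_U S† f‖ ≤ 2e^{‖κ‖ℓη}M_φM_φ′√d·δ·‖f‖` (the adjoints act as `e^{−κ̄χ(b₋)}`, `e^{κ̄χ}`). [folklore]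
[cite: Balaban1985BackgroundPropagators, (3.3) pp.390–391, (3.49) p.399, (3.101) p.414] -/
theorem norm_conjDm_sub_conjDm_le (f : SiteL2K ℂ d (towerP L m (n + 1)) c₀ W) :
    ‖(LinearMap.adjoint SBinv ∘ₗ covDerivL2K ℂ c₀ ((η : ℂ))⁻¹ (adTransportW φ V) ∘ₗ LinearMap.adjoint S) f -
        (LinearMap.adjoint SBinv ∘ₗ covDerivL2K ℂ c₀ ((η : ℂ))⁻¹ (adTransportW φ U) ∘ₗ LinearMap.adjoint S) f‖ ≤
      2 * Real.exp (‖κ‖ * (ℓ * η)) * (Mφ * Mφ') * Real.sqrt d * δ * ‖f‖ := by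
  have hT : ∀ (b : Bond d (towerP L m (n + 1))) (v : W), ‖adTransportW φ V b v - adTransportW φ U b v‖ ≤ 2 * Mφ * Mφ' * (δ * η) * ‖v‖ :=
    fun b v => norm_adTransportW_sub_adTransportW_le L (towerP L m n) φ hφ hφ' hMφ' V U b (hV b) (hU b)
      (by rw [norm_sub_rev]; exact hUV b) v
  have hA : ∀ (g : BondL2K ℂ d (towerP L m (n + 1)) c₀ W) (b : Bond d (towerP L m (n + 1))),
      WL2.equiv ℂ (fun _ : Bond d (towerP L m (n + 1)) => c₀) W (LinearMap.adjoint SBinv g) b =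
        Complex.exp (-conj κ * (χ (bpos b) : ℂ)) • WL2.equiv ℂ (fun _ : Bond d (towerP L m (n + 1)) => c₀) W g b := by
    intro g b
    rw [B9Eq311PointwiseMultipliers.equiv_adjoint_of_pointwise SBinv _ hSBinv, ← Complex.exp_conj, map_neg, map_mul, Complex.conj_ofReal,
      neg_mul]
  have hB : ∀ (f : SiteL2K ℂ d (towerP L m (n + 1)) c₀ W) (x : TSite d (towerP L m (n + 1))),
      WL2.equiv ℂ (fun _ : TSite d (towerP L m (n + 1)) => c₀) W (LinearMap.adjoint S f) x =
        Complex.exp (-(-conj κ * (χ x : ℂ))) • WL2.equiv ℂ (fun _ : TSite d (towerP L m (n + 1)) => c₀) W f x := by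
    intro f x
    rw [B9Eq311PointwiseMultipliers.equiv_adjoint_of_pointwise S _ hS, ← Complex.exp_conj, map_mul, Complex.conj_ofReal, neg_mul, neg_neg]
  have h := norm_mulOp_covDerivL2K_sub_covDerivL2K_le (c₀ := c₀) (by positivity : (0 : ℝ) ≤ 2 * Mφ * Mφ' * (δ * η)) hT hχ ((η : ℂ))⁻¹
    (LinearMap.adjoint SBinv) hA (LinearMap.adjoint S) hB f
  rw [norm_neg, Complex.norm_conj] at h
  have hηn : ‖((η : ℂ))⁻¹‖ = η⁻¹ := by rw [norm_inv, Complex.norm_real, Real.norm_eq_abs, abs_of_pos hη]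
  simp only [LinearMap.comp_apply]
  calc _ ≤ ‖((η : ℂ))⁻¹‖ * Real.exp (‖κ‖ * (ℓ * η)) * (2 * Mφ * Mφ' * (δ * η)) * Real.sqrt d * ‖f‖ := h
    _ = 2 * Real.exp (‖κ‖ * (ℓ * η)) * (Mφ * Mφ') * Real.sqrt d * δ * ‖f‖ := by
        rw [hηn]; field_simp

omit [NeZero L] [∀ i, NeZero (m i)] [Fact (0 < c₁)] [CompleteSpace 𝔸] in
include hφ hφ' hMφ hMφ' hη hU hV hχ hS hSBinv hδ hUV in
/-- **`b_{D′}` AT THE TOWER** (the adjoint sides `S D_X† S_B⁻¹`, through the pairing `B9Eq324ConjugatedFormDifference.norm_le_of_inner_eq_inner`):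
`‖S D_V† S_B⁻¹ e − S D_U† S_B⁻¹ e‖ ≤ 2e^{‖κ‖ℓη}M_φM_φ′√d·δ·‖e‖`. [folklore] [cite: Balaban1985BackgroundPropagators, (3.3) pp.390–391, (3.49) p.399, (3.101) p.414] -/
theorem norm_conjD'_sub_conjD'_le (e : BondL2K ℂ d (towerP L m (n + 1)) c₀ W) :
    ‖(S ∘ₗ LinearMap.adjoint (covDerivL2K ℂ c₀ ((η : ℂ))⁻¹ (adTransportW φ V)) ∘ₗ SBinv) e -
        (S ∘ₗ LinearMap.adjoint (covDerivL2K ℂ c₀ ((η : ℂ))⁻¹ (adTransportW φ U)) ∘ₗ SBinv) e‖ ≤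
      2 * Real.exp (‖κ‖ * (ℓ * η)) * (Mφ * Mφ') * Real.sqrt d * δ * ‖e‖ := by
  refine B9Eq324ConjugatedFormDifference.norm_le_of_inner_eq_inner (𝕜 := ℂ)
    (K := fun e => (S ∘ₗ LinearMap.adjoint (covDerivL2K ℂ c₀ ((η : ℂ))⁻¹ (adTransportW φ V)) ∘ₗ SBinv) e -
      (S ∘ₗ LinearMap.adjoint (covDerivL2K ℂ c₀ ((η : ℂ))⁻¹ (adTransportW φ U)) ∘ₗ SBinv) e)
    (L := fun f => (LinearMap.adjoint SBinv ∘ₗ covDerivL2K ℂ c₀ ((η : ℂ))⁻¹ (adTransportW φ V) ∘ₗ LinearMap.adjoint S) f -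
      (LinearMap.adjoint SBinv ∘ₗ covDerivL2K ℂ c₀ ((η : ℂ))⁻¹ (adTransportW φ U) ∘ₗ LinearMap.adjoint S) f)
    (by positivity) (fun e f => ?_) (fun f => norm_conjDm_sub_conjDm_le hφ hφ' hMφ hMφ' hη hU hV hχ hS hSBinv hδ hUV f) e
  simp only [LinearMap.comp_apply, inner_sub_left, inner_sub_right, LinearMap.adjoint_inner_left, ← LinearMap.adjoint_inner_right S,
    ← LinearMap.adjoint_inner_right SBinv]

omit [NormOneClass 𝔸] in
include hS hSinv hSG hSGinv in
/-- **`S R_k(X) S⁻¹ x = x − word_κ(X)x`** with the conjugated word `G_κQ′_κc_κQ_κG_κ` (`G_κ = SG′_kS⁻¹`, `Q′_κ = SQ̃′_k†S_G⁻¹`, `c_κ = S_G(Q̃′G′²Q̃′†)⁻¹S_G⁻¹`,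
`Q_κ = S_GQ̃′_kS⁻¹`; `S⁻¹S = 1`, `S_G⁻¹S_G = 1` inserted) — (3.25) `1 − R = G′Q̃′†(Q̃′G′²Q̃′†)⁻¹Q̃′G′` conjugated factor by factor. [folklore]
[cite: Balaban1985BackgroundPropagators, (3.21) p.394, (3.25) p.394, (3.49) p.399] -/
theorem conj_RofUk_eq_sub_word {X : Bond d (towerP L m (n + 1)) → 𝔸ˣ}
    (hRSX : ∀ (b : Bond d (towerP L m (n + 1))) (v u : W), ⟪adTransportW φ X b v, u⟫_ℂ = ⟪v, adTransportW φ (fun b => (X b)⁻¹) b u⟫_ℂ)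
    (hpos'X : ∀ x : SiteL2K ℂ d (towerP L m (n + 1)) c₀ W, x ≠ 0 → 0 < RCLike.re ⟪x, laplacePrimeAk L m n φ η X a' (c₁ := c₁) x⟫_ℂ)
    (x : SiteL2K ℂ d (towerP L m (n + 1)) c₀ W) :
    S (RofUk L m n φ η X (c₀ := c₀) (Sinv x)) = x -
      (S ∘ₗ GpOfUk L m n φ η X a' (c₁ := c₁) hpos'X ∘ₗ Sinv)
        ((S ∘ₗ LinearMap.adjoint ((WL2.linearEquiv ℂ ℂ (fun _ : TSite d m => c₁)).symm.toLinearMap ∘ₗ QprimeTowerW L m n φ X (c₀ := c₀)) ∘ₗ SGinv)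
          ((SG ∘ₗ greenK _ (QGGQk_pos L m n φ c₀ η X c₁ a' hRSX hpos'X) ∘ₗ SGinv)
            ((SG ∘ₗ ((WL2.linearEquiv ℂ ℂ (fun _ : TSite d m => c₁)).symm.toLinearMap ∘ₗ QprimeTowerW L m n φ X (c₀ := c₀)) ∘ₗ Sinv)
              ((S ∘ₗ GpOfUk L m n φ η X a' (c₁ := c₁) hpos'X ∘ₗ Sinv) x)))) := by
  have h1 := one_sub_RofUk_apply_eq L m n φ c₀ η X c₁ a' hRSX hpos'X (Sinv x)
  have e : RofUk L m n φ η X (c₀ := c₀) (Sinv x) = Sinv x -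
      (GpOfUk L m n φ η X a' (c₁ := c₁) hpos'X ∘ₗ
        LinearMap.adjoint ((WL2.linearEquiv ℂ ℂ (fun _ : TSite d m => c₁)).symm.toLinearMap ∘ₗ QprimeTowerW L m n φ X (c₀ := c₀)))
        (greenK _ (QGGQk_pos L m n φ c₀ η X c₁ a' hRSX hpos'X)
          (((WL2.linearEquiv ℂ ℂ (fun _ : TSite d m => c₁)).symm.toLinearMap ∘ₗ QprimeTowerW L m n φ X (c₀ := c₀))
            (GpOfUk L m n φ η X a' (c₁ := c₁) hpos'X (Sinv x)))) := by
    rw [← h1, sub_sub_cancel]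
  rw [e, map_sub, S_Sinv hS hSinv]
  simp only [LinearMap.comp_apply, Sinv_S hS hSinv, SGinv_SG hSG hSGinv]

include hφ hφ' hMφ hMφ' hη hU hV ha' hRSU hRSV hℓ hℓ' hχ hχ' hwin hwin' hS hSinv hSB hSBinv hSG hSGinv hδ hUV hεU hδUV hLεU hLεV hLbU hLbV hLUV in
/-- **THE CONJUGATED TWO-BACKGROUND LETTER OF `R_k` AT THE TOWER, every height**: `‖S(R_k(V)(S⁻¹x)) − S(R_k(U)(S⁻¹x))‖ ≤ ρ₂·‖x‖` with
`ρ₂ = σC_cn + n(C_c(σn + nσ)C_c)n + nC_cσ`, `n = (4∕γ′)(M+1)`, `C_c = 2∕κ₁`, and the DEFINITIONAL binders `b_D = 2e^{‖κ‖ℓη}M_φM_φ′√d·δ` (gen 88's letter),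
`b_Q = e^{‖κ‖ℓ′}·P_ε(T_{ε,δ} − 1)√(c₁∕(c₀L^{(n+1)d}))` (I-8), `σ = (4∕γ′)b_Q + b_Q(4∕γ′) + 2(M+1)(4∕γ′)²(2b_D + (1+β′)b_D + a′(M+1)(b_Q + b_Q))` — I-10's
`norm_Pk_sub_Pk_le` at the two tower families (leaf-03's structure lemmas, the (I4) letters `β′`, `norm_ck_le` ×2), via `conj_RofUk_eq_sub_word` at `U` and at `V`.
[folklore] [cite: Balaban1985BackgroundPropagators, (3.21) p.394, (3.25) p.394, (3.49) p.399, Thm 3.11 p.416] -/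
theorem norm_conjRofUk_sub_conjRofUk_le {γ κ₁ M β : ℝ} (hγ : 0 < γ) (hγ1 : γ ≤ 1) (hκ₁ : 0 < κ₁) (hM : 0 ≤ M) (hβ : 0 ≤ β) (hβ1 : β ≤ 1)
    (coerciveU : ∀ f : SiteL2K ℂ d (towerP L m (n + 1)) c₀ W, γ * ‖f‖ ^ 2 ≤ ‖(covDerivL2K ℂ c₀ ((η : ℂ))⁻¹ (adTransportW φ U)) f‖ ^ 2 +
      a' * ‖((WL2.linearEquiv ℂ ℂ (fun _ : TSite d m => c₁)).symm.toLinearMap ∘ₗ QprimeTowerW L m n φ U (c₀ := c₀)) f‖ ^ 2)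
    (coerciveV : ∀ f : SiteL2K ℂ d (towerP L m (n + 1)) c₀ W, γ * ‖f‖ ^ 2 ≤ ‖(covDerivL2K ℂ c₀ ((η : ℂ))⁻¹ (adTransportW φ V)) f‖ ^ 2 +
      a' * ‖((WL2.linearEquiv ℂ ℂ (fun _ : TSite d m => c₁)).symm.toLinearMap ∘ₗ QprimeTowerW L m n φ V (c₀ := c₀)) f‖ ^ 2)
    (hκU : ∀ ψ : SiteL2K ℂ d m c₁ W, κ₁ * ‖ψ‖ ^ 2 ≤ RCLike.re ⟪ψ,
      (((WL2.linearEquiv ℂ ℂ (fun _ : TSite d m => c₁)).symm.toLinearMap ∘ₗ QprimeTowerW L m n φ U (c₀ := c₀)) ∘ₗ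
        GpOfUk L m n φ η U a' (c₁ := c₁) hpos'U ∘ₗ GpOfUk L m n φ η U a' (c₁ := c₁) hpos'U ∘ₗ
        LinearMap.adjoint ((WL2.linearEquiv ℂ ℂ (fun _ : TSite d m => c₁)).symm.toLinearMap ∘ₗ QprimeTowerW L m n φ U (c₀ := c₀))) ψ⟫_ℂ)
    (hκV : ∀ ψ : SiteL2K ℂ d m c₁ W, κ₁ * ‖ψ‖ ^ 2 ≤ RCLike.re ⟪ψ,
      (((WL2.linearEquiv ℂ ℂ (fun _ : TSite d m => c₁)).symm.toLinearMap ∘ₗ QprimeTowerW L m n φ V (c₀ := c₀)) ∘ₗ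
        GpOfUk L m n φ η V a' (c₁ := c₁) hpos'V ∘ₗ GpOfUk L m n φ η V a' (c₁ := c₁) hpos'V ∘ₗ
        LinearMap.adjoint ((WL2.linearEquiv ℂ ℂ (fun _ : TSite d m => c₁)).symm.toLinearMap ∘ₗ QprimeTowerW L m n φ V (c₀ := c₀))) ψ⟫_ℂ)
    (hMQU : ∀ s : SiteL2K ℂ d (towerP L m (n + 1)) c₀ W,
      ‖((WL2.linearEquiv ℂ ℂ (fun _ : TSite d m => c₁)).symm.toLinearMap ∘ₗ QprimeTowerW L m n φ U (c₀ := c₀)) s‖ ≤ M * ‖s‖)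
    (hMQV : ∀ s : SiteL2K ℂ d (towerP L m (n + 1)) c₀ W,
      ‖((WL2.linearEquiv ℂ ℂ (fun _ : TSite d m => c₁)).symm.toLinearMap ∘ₗ QprimeTowerW L m n φ V (c₀ := c₀)) s‖ ≤ M * ‖s‖)
    (hβD : 2 * ‖κ‖ * ℓ * (Mφ * Mφ') * Real.sqrt d ≤ β) (hβQ : 2 * ‖κ‖ * ℓ' * M ≤ β)
    (small : 3 * (1 + a') * β ^ 2 ≤ γ / 4)
    (hwinc : β * ((4 / γ + M * ((4 / γ) ^ 2 * (3 + a' * (2 * M + 1)))) * (4 / γ) * (2 * M + 1)) ≤ κ₁ / 2)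
    {bD bQ σ : ℝ} (hbD : bD = 2 * Real.exp (‖κ‖ * (ℓ * η)) * (Mφ * Mφ') * Real.sqrt d * δ)
    (hbQ : bQ = Real.exp (‖κ‖ * ℓ') * ((∏ j ∈ Finset.range (n + 1), (1 + 2 * Mφ * Mφ' * εU j) ^ (d * (L - 1))) *
        ((∏ j ∈ Finset.range (n + 1), (1 + (d * (L - 1) : ℕ) * (2 * Mφ * Mφ' * δUV j) * (1 + 2 * Mφ * Mφ' * εU j) ^ (d * (L - 1)))) - 1) *
        Real.sqrt (c₁ / (c₀ * ((L : ℝ) ^ (n + 1)) ^ d))))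
    (hσ : σ = 4 / γ * bQ + bQ * (4 / γ) + 2 * (M + 1) * ((4 / γ) ^ 2 * (2 * bD + (1 + β) * bD + a' * (M + 1) * (bQ + bQ))))
    (x : SiteL2K ℂ d (towerP L m (n + 1)) c₀ W) :
    ‖S (RofUk L m n φ η V (c₀ := c₀) (Sinv x)) - S (RofUk L m n φ η U (c₀ := c₀) (Sinv x))‖ ≤
      (σ * (2 / κ₁) * (4 / γ * (M + 1)) +
          4 / γ * (M + 1) * ((2 / κ₁) * (σ * (4 / γ * (M + 1)) + 4 / γ * (M + 1) * σ) * (2 / κ₁)) * (4 / γ * (M + 1)) +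
        4 / γ * (M + 1) * (2 / κ₁) * σ) * ‖x‖ := by
  -- (0) the two-background letters are nonnegative
  have hbD0 : 0 ≤ bD := by rw [hbD]; positivity
  have hbQ0 : 0 ≤ bQ := by
    rw [hbQ]
    exact mul_nonneg (Real.exp_pos _).le (B9Eq349ConjugatedQprimeTowerTwoBackgrounds.deltaQprime_of_levels (L := L) (m := m) (n := n) φ
      hMφ hMφ' hφ hφ' (c₀ := c₀) (c₁ := c₁) U V εU δUV hεU hδUV hLεU hLεV hLbU hLbV hLUV).1
  -- (1) the (I4) letters `β′` of the two families
  have dDU : ∀ y, ‖(SB ∘ₗ (covDerivL2K ℂ c₀ ((η : ℂ))⁻¹ (adTransportW φ U)) ∘ₗ Sinv) y - (covDerivL2K ℂ c₀ ((η : ℂ))⁻¹ (adTransportW φ U)) y‖ ≤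
      β * ‖y‖ := fun y => (norm_Dp_sub_le (L := L) (m := towerP L m n) hφ hφ' hMφ hMφ' hη hU hℓ hχ hwin hSinv hSB y).trans
    (mul_le_mul_of_nonneg_right hβD (norm_nonneg _))
  have dDU' : ∀ e, ‖(S ∘ₗ LinearMap.adjoint (covDerivL2K ℂ c₀ ((η : ℂ))⁻¹ (adTransportW φ U)) ∘ₗ SBinv) e -
      LinearMap.adjoint (covDerivL2K ℂ c₀ ((η : ℂ))⁻¹ (adTransportW φ U)) e‖ ≤ β * ‖e‖ := fun e =>
    (norm_Dp'_sub_le (L := L) (m := towerP L m n) hφ hφ' hMφ hMφ' hη hU hℓ hχ hwin hS hSBinv e).trans (mul_le_mul_of_nonneg_right hβD (norm_nonneg _))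
  have dDV : ∀ y, ‖(SB ∘ₗ (covDerivL2K ℂ c₀ ((η : ℂ))⁻¹ (adTransportW φ V)) ∘ₗ Sinv) y - (covDerivL2K ℂ c₀ ((η : ℂ))⁻¹ (adTransportW φ V)) y‖ ≤
      β * ‖y‖ := fun y => (norm_Dp_sub_le (L := L) (m := towerP L m n) hφ hφ' hMφ hMφ' hη hV hℓ hχ hwin hSinv hSB y).trans
    (mul_le_mul_of_nonneg_right hβD (norm_nonneg _))
  have dDV' : ∀ e, ‖(S ∘ₗ LinearMap.adjoint (covDerivL2K ℂ c₀ ((η : ℂ))⁻¹ (adTransportW φ V)) ∘ₗ SBinv) e -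
      LinearMap.adjoint (covDerivL2K ℂ c₀ ((η : ℂ))⁻¹ (adTransportW φ V)) e‖ ≤ β * ‖e‖ := fun e =>
    (norm_Dp'_sub_le (L := L) (m := towerP L m n) hφ hφ' hMφ hMφ' hη hV hℓ hχ hwin hS hSBinv e).trans (mul_le_mul_of_nonneg_right hβD (norm_nonneg _))
  have dQU : ∀ y, ‖(SG ∘ₗ ((WL2.linearEquiv ℂ ℂ (fun _ : TSite d m => c₁)).symm.toLinearMap ∘ₗ QprimeTowerW L m n φ U (c₀ := c₀)) ∘ₗ Sinv) y -
      ((WL2.linearEquiv ℂ ℂ (fun _ : TSite d m => c₁)).symm.toLinearMap ∘ₗ QprimeTowerW L m n φ U (c₀ := c₀)) y‖ ≤ β * ‖y‖ := fun y =>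
    (norm_QpTower_sub_le (φ := φ) (U := U) (c₁ := c₁) hℓ' hχ' hwin' hM hMQU hSinv hSG y).trans (mul_le_mul_of_nonneg_right hβQ (norm_nonneg _))
  have dQU' : ∀ g, ‖(S ∘ₗ LinearMap.adjoint ((WL2.linearEquiv ℂ ℂ (fun _ : TSite d m => c₁)).symm.toLinearMap ∘ₗ QprimeTowerW L m n φ U (c₀ := c₀)) ∘ₗ
      SGinv) g - LinearMap.adjoint ((WL2.linearEquiv ℂ ℂ (fun _ : TSite d m => c₁)).symm.toLinearMap ∘ₗ QprimeTowerW L m n φ U (c₀ := c₀)) g‖ ≤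
      β * ‖g‖ := fun g =>
    (norm_QpTower'_sub_le (φ := φ) (U := U) (c₁ := c₁) hℓ' hχ' hwin' hM hMQU hS hSGinv g).trans (mul_le_mul_of_nonneg_right hβQ (norm_nonneg _))
  have dQV : ∀ y, ‖(SG ∘ₗ ((WL2.linearEquiv ℂ ℂ (fun _ : TSite d m => c₁)).symm.toLinearMap ∘ₗ QprimeTowerW L m n φ V (c₀ := c₀)) ∘ₗ Sinv) y -
      ((WL2.linearEquiv ℂ ℂ (fun _ : TSite d m => c₁)).symm.toLinearMap ∘ₗ QprimeTowerW L m n φ V (c₀ := c₀)) y‖ ≤ β * ‖y‖ := fun y =>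
    (norm_QpTower_sub_le (φ := φ) (U := V) (c₁ := c₁) hℓ' hχ' hwin' hM hMQV hSinv hSG y).trans (mul_le_mul_of_nonneg_right hβQ (norm_nonneg _))
  have dQV' : ∀ g, ‖(S ∘ₗ LinearMap.adjoint ((WL2.linearEquiv ℂ ℂ (fun _ : TSite d m => c₁)).symm.toLinearMap ∘ₗ QprimeTowerW L m n φ V (c₀ := c₀)) ∘ₗ
      SGinv) g - LinearMap.adjoint ((WL2.linearEquiv ℂ ℂ (fun _ : TSite d m => c₁)).symm.toLinearMap ∘ₗ QprimeTowerW L m n φ V (c₀ := c₀)) g‖ ≤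
      β * ‖g‖ := fun g =>
    (norm_QpTower'_sub_le (φ := φ) (U := V) (c₁ := c₁) hℓ' hχ' hwin' hM hMQV hS hSGinv g).trans (mul_le_mul_of_nonneg_right hβQ (norm_nonneg _))
  -- (2) the structure `H = D†D + a′Q̃′†Q̃′`, `HG = 1`, `H₊ = D₊′D₊ + a′Q̃′₊′Q̃′₊`, `H₊G₊ = 1 = G₊H₊` at `U` and at `V`
  have hHU := laplacePrimeAk_apply_eq (L := L) (m := m) (n := n) (φ := φ) (c₀ := c₀) (η := η) (U := U) (c₁ := c₁) (a' := a') hRSU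
  have hHGU := laplacePrimeAk_GpOfUk_apply (L := L) (m := m) (n := n) (φ := φ) (η := η) (U := U) (a' := a') (c₁ := c₁) hpos'U
  have hHkU := conjHk_plus_apply hRSU hSB hSBinv hSG hSGinv (η := η) (a' := a') (S := S) (Sinv := Sinv)
  have hHkGkU := conjHk_plus_conjGk hpos'U hS hSinv
  have hGkHkU := conjGk_plus_conjHk hpos'U hS hSinv
  have hHV := laplacePrimeAk_apply_eq (L := L) (m := m) (n := n) (φ := φ) (c₀ := c₀) (η := η) (U := V) (c₁ := c₁) (a' := a') hRSV
  have hHGV := laplacePrimeAk_GpOfUk_apply (L := L) (m := m) (n := n) (φ := φ) (η := η) (U := V) (a' := a') (c₁ := c₁) hpos'V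
  have hHkV := conjHk_plus_apply hRSV hSB hSBinv hSG hSGinv (η := η) (a' := a') (S := S) (Sinv := Sinv)
  have hHkGkV := conjHk_plus_conjGk hpos'V hS hSinv
  have hGkHkV := conjGk_plus_conjHk hpos'V hS hSinv
  -- (3) the four two-background letters
  have tD : ∀ s, ‖(SB ∘ₗ (covDerivL2K ℂ c₀ ((η : ℂ))⁻¹ (adTransportW φ V)) ∘ₗ Sinv) s -
      (SB ∘ₗ (covDerivL2K ℂ c₀ ((η : ℂ))⁻¹ (adTransportW φ U)) ∘ₗ Sinv) s‖ ≤ bD * ‖s‖ := fun s => by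
    rw [hbD]; exact norm_conjD_sub_conjD_le hφ hφ' hMφ hMφ' hη hU hV hχ hSinv hSB hδ hUV s
  have tD' : ∀ e, ‖(S ∘ₗ LinearMap.adjoint (covDerivL2K ℂ c₀ ((η : ℂ))⁻¹ (adTransportW φ V)) ∘ₗ SBinv) e -
      (S ∘ₗ LinearMap.adjoint (covDerivL2K ℂ c₀ ((η : ℂ))⁻¹ (adTransportW φ U)) ∘ₗ SBinv) e‖ ≤ bD * ‖e‖ := fun e => by
    rw [hbD]; exact norm_conjD'_sub_conjD'_le hφ hφ' hMφ hMφ' hη hU hV hχ hS hSBinv hδ hUV e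
  have tQ : ∀ s, ‖(SG ∘ₗ ((WL2.linearEquiv ℂ ℂ (fun _ : TSite d m => c₁)).symm.toLinearMap ∘ₗ QprimeTowerW L m n φ V (c₀ := c₀)) ∘ₗ Sinv) s -
      (SG ∘ₗ ((WL2.linearEquiv ℂ ℂ (fun _ : TSite d m => c₁)).symm.toLinearMap ∘ₗ QprimeTowerW L m n φ U (c₀ := c₀)) ∘ₗ Sinv) s‖ ≤ bQ * ‖s‖ :=
    fun s => by
    rw [hbQ]
    exact norm_QpTower_sub_QpTower_le_of_levels (L := L) (m := m) (n := n) φ hMφ hMφ' hφ hφ' (c₀ := c₀) (c₁ := c₁) U V εU δUV hεU hδUV hLεU hLεV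
      hLbU hLbV hLUV hχ' hSinv hSG s
  have tQ' : ∀ g, ‖(S ∘ₗ LinearMap.adjoint ((WL2.linearEquiv ℂ ℂ (fun _ : TSite d m => c₁)).symm.toLinearMap ∘ₗ QprimeTowerW L m n φ V (c₀ := c₀)) ∘ₗ
      SGinv) g - (S ∘ₗ LinearMap.adjoint ((WL2.linearEquiv ℂ ℂ (fun _ : TSite d m => c₁)).symm.toLinearMap ∘ₗ QprimeTowerW L m n φ U (c₀ := c₀)) ∘ₗ
      SGinv) g‖ ≤ bQ * ‖g‖ := fun g => by
    rw [hbQ]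
    exact norm_QpTower'_sub_QpTower'_le_of_levels (L := L) (m := m) (n := n) φ hMφ hMφ' hφ hφ' (c₀ := c₀) (c₁ := c₁) U V εU δUV hεU hδUV hLεU
      hLεV hLbU hLbV hLUV hχ' hS hSGinv g
  -- (4) the conjugated Gram data at `U` and at `V`
  have hXU : ∀ g : SiteL2K ℂ d m c₁ W, κ₁ * ‖g‖ ^ 2 ≤ RCLike.re ⟪g,
      ((WL2.linearEquiv ℂ ℂ (fun _ : TSite d m => c₁)).symm.toLinearMap ∘ₗ QprimeTowerW L m n φ U (c₀ := c₀))
        (GpOfUk L m n φ η U a' (c₁ := c₁) hpos'U (GpOfUk L m n φ η U a' (c₁ := c₁) hpos'U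
          (LinearMap.adjoint ((WL2.linearEquiv ℂ ℂ (fun _ : TSite d m => c₁)).symm.toLinearMap ∘ₗ QprimeTowerW L m n φ U (c₀ := c₀)) g)))⟫_ℂ :=
    fun g => by simpa only [LinearMap.comp_apply] using hκU g
  have hXV : ∀ g : SiteL2K ℂ d m c₁ W, κ₁ * ‖g‖ ^ 2 ≤ RCLike.re ⟪g,
      ((WL2.linearEquiv ℂ ℂ (fun _ : TSite d m => c₁)).symm.toLinearMap ∘ₗ QprimeTowerW L m n φ V (c₀ := c₀))
        (GpOfUk L m n φ η V a' (c₁ := c₁) hpos'V (GpOfUk L m n φ η V a' (c₁ := c₁) hpos'V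
          (LinearMap.adjoint ((WL2.linearEquiv ℂ ℂ (fun _ : TSite d m => c₁)).symm.toLinearMap ∘ₗ QprimeTowerW L m n φ V (c₀ := c₀)) g)))⟫_ℂ :=
    fun g => by simpa only [LinearMap.comp_apply] using hκV g
  have hXcU : ∀ w, ((WL2.linearEquiv ℂ ℂ (fun _ : TSite d m => c₁)).symm.toLinearMap ∘ₗ QprimeTowerW L m n φ U (c₀ := c₀))
      (GpOfUk L m n φ η U a' (c₁ := c₁) hpos'U (GpOfUk L m n φ η U a' (c₁ := c₁) hpos'U
        (LinearMap.adjoint ((WL2.linearEquiv ℂ ℂ (fun _ : TSite d m => c₁)).symm.toLinearMap ∘ₗ QprimeTowerW L m n φ U (c₀ := c₀))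
          (greenK _ (QGGQk_pos L m n φ c₀ η U c₁ a' hRSU hpos'U) w)))) = w :=
    fun w => by simpa only [LinearMap.comp_apply] using apply_greenK (QGGQk_pos L m n φ c₀ η U c₁ a' hRSU hpos'U) w
  have hXcV : ∀ w, ((WL2.linearEquiv ℂ ℂ (fun _ : TSite d m => c₁)).symm.toLinearMap ∘ₗ QprimeTowerW L m n φ V (c₀ := c₀))
      (GpOfUk L m n φ η V a' (c₁ := c₁) hpos'V (GpOfUk L m n φ η V a' (c₁ := c₁) hpos'V
        (LinearMap.adjoint ((WL2.linearEquiv ℂ ℂ (fun _ : TSite d m => c₁)).symm.toLinearMap ∘ₗ QprimeTowerW L m n φ V (c₀ := c₀))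
          (greenK _ (QGGQk_pos L m n φ c₀ η V c₁ a' hRSV hpos'V) w)))) = w :=
    fun w => by simpa only [LinearMap.comp_apply] using apply_greenK (QGGQk_pos L m n φ c₀ η V c₁ a' hRSV hpos'V) w
  have hcXV : ∀ u, greenK _ (QGGQk_pos L m n φ c₀ η V c₁ a' hRSV hpos'V)
      (((WL2.linearEquiv ℂ ℂ (fun _ : TSite d m => c₁)).symm.toLinearMap ∘ₗ QprimeTowerW L m n φ V (c₀ := c₀))
        (GpOfUk L m n φ η V a' (c₁ := c₁) hpos'V (GpOfUk L m n φ η V a' (c₁ := c₁) hpos'V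
          (LinearMap.adjoint ((WL2.linearEquiv ℂ ℂ (fun _ : TSite d m => c₁)).symm.toLinearMap ∘ₗ QprimeTowerW L m n φ V (c₀ := c₀)) u)))) = u :=
    fun u => by simpa only [LinearMap.comp_apply] using greenK_apply (QGGQk_pos L m n φ c₀ η V c₁ a' hRSV hpos'V) u
  have hckU : ∀ v, (SG ∘ₗ ((WL2.linearEquiv ℂ ℂ (fun _ : TSite d m => c₁)).symm.toLinearMap ∘ₗ QprimeTowerW L m n φ U (c₀ := c₀)) ∘ₗ Sinv)
      ((S ∘ₗ GpOfUk L m n φ η U a' (c₁ := c₁) hpos'U ∘ₗ Sinv) ((S ∘ₗ GpOfUk L m n φ η U a' (c₁ := c₁) hpos'U ∘ₗ Sinv)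
        ((S ∘ₗ LinearMap.adjoint ((WL2.linearEquiv ℂ ℂ (fun _ : TSite d m => c₁)).symm.toLinearMap ∘ₗ QprimeTowerW L m n φ U (c₀ := c₀)) ∘ₗ SGinv)
          ((SG ∘ₗ greenK _ (QGGQk_pos L m n φ c₀ η U c₁ a' hRSU hpos'U) ∘ₗ SGinv) v)))) = v := fun v => by
    simp only [LinearMap.comp_apply, Sinv_S hS hSinv, SGinv_SG hSG hSGinv, hXcU, SG_SGinv hSG hSGinv]
  have hckV : ∀ v, (SG ∘ₗ ((WL2.linearEquiv ℂ ℂ (fun _ : TSite d m => c₁)).symm.toLinearMap ∘ₗ QprimeTowerW L m n φ V (c₀ := c₀)) ∘ₗ Sinv)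
      ((S ∘ₗ GpOfUk L m n φ η V a' (c₁ := c₁) hpos'V ∘ₗ Sinv) ((S ∘ₗ GpOfUk L m n φ η V a' (c₁ := c₁) hpos'V ∘ₗ Sinv)
        ((S ∘ₗ LinearMap.adjoint ((WL2.linearEquiv ℂ ℂ (fun _ : TSite d m => c₁)).symm.toLinearMap ∘ₗ QprimeTowerW L m n φ V (c₀ := c₀)) ∘ₗ SGinv)
          ((SG ∘ₗ greenK _ (QGGQk_pos L m n φ c₀ η V c₁ a' hRSV hpos'V) ∘ₗ SGinv) v)))) = v := fun v => by
    simp only [LinearMap.comp_apply, Sinv_S hS hSinv, SGinv_SG hSG hSGinv, hXcV, SG_SGinv hSG hSGinv]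
  have hkcV : ∀ h, (SG ∘ₗ greenK _ (QGGQk_pos L m n φ c₀ η V c₁ a' hRSV hpos'V) ∘ₗ SGinv)
      ((SG ∘ₗ ((WL2.linearEquiv ℂ ℂ (fun _ : TSite d m => c₁)).symm.toLinearMap ∘ₗ QprimeTowerW L m n φ V (c₀ := c₀)) ∘ₗ Sinv)
        ((S ∘ₗ GpOfUk L m n φ η V a' (c₁ := c₁) hpos'V ∘ₗ Sinv) ((S ∘ₗ GpOfUk L m n φ η V a' (c₁ := c₁) hpos'V ∘ₗ Sinv)
          ((S ∘ₗ LinearMap.adjoint ((WL2.linearEquiv ℂ ℂ (fun _ : TSite d m => c₁)).symm.toLinearMap ∘ₗ QprimeTowerW L m n φ V (c₀ := c₀)) ∘ₗ SGinv)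
            h)))) = h := fun h => by
    have e1 := hcXV (SGinv h)
    simp only [LinearMap.comp_apply] at e1
    simp only [LinearMap.comp_apply, Sinv_S hS hSinv, SGinv_SG hSG hSGinv]
    rw [e1, SG_SGinv hSG hSGinv]
  have nckU : ∀ v, ‖(SG ∘ₗ greenK _ (QGGQk_pos L m n φ c₀ η U c₁ a' hRSU hpos'U) ∘ₗ SGinv) v‖ ≤ 2 / κ₁ * ‖v‖ := fun v =>
    norm_ck_le (covDerivL2K ℂ c₀ ((η : ℂ))⁻¹ (adTransportW φ U))
      (((WL2.linearEquiv ℂ ℂ (fun _ : TSite d m => c₁)).symm.toLinearMap ∘ₗ QprimeTowerW L m n φ U (c₀ := c₀) :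
        SiteL2K ℂ d (towerP L m (n + 1)) c₀ W →ₗ[ℂ] SiteL2K ℂ d m c₁ W)) a' γ M β _ _ _ _ (laplacePrimeAk L m n φ η U a' (c₁ := c₁)) _
      (GpOfUk L m n φ η U a' (c₁ := c₁) hpos'U) _ ha' hγ hγ1 hM hβ hβ1 coerciveU hMQU dDU dDU' dQU dQU' small hHU hHGU hHkU hHkGkU hGkHkU hκ₁ hXU _
      hckU hwinc v
  have nckV : ∀ v, ‖(SG ∘ₗ greenK _ (QGGQk_pos L m n φ c₀ η V c₁ a' hRSV hpos'V) ∘ₗ SGinv) v‖ ≤ 2 / κ₁ * ‖v‖ := fun v =>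
    norm_ck_le (covDerivL2K ℂ c₀ ((η : ℂ))⁻¹ (adTransportW φ V))
      (((WL2.linearEquiv ℂ ℂ (fun _ : TSite d m => c₁)).symm.toLinearMap ∘ₗ QprimeTowerW L m n φ V (c₀ := c₀) :
        SiteL2K ℂ d (towerP L m (n + 1)) c₀ W →ₗ[ℂ] SiteL2K ℂ d m c₁ W)) a' γ M β _ _ _ _ (laplacePrimeAk L m n φ η V a' (c₁ := c₁)) _
      (GpOfUk L m n φ η V a' (c₁ := c₁) hpos'V) _ ha' hγ hγ1 hM hβ hβ1 coerciveV hMQV dDV dDV' dQV dQV' small hHV hHGV hHkV hHkGkV hGkHkV hκ₁ hXV _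
      hckV hwinc v
  -- (5) assemble: `S R_k(X) S⁻¹ x = x − word_κ(X) x`, then I-10's word difference
  rw [conj_RofUk_eq_sub_word (a' := a') hS hSinv hSG hSGinv hRSV hpos'V x, conj_RofUk_eq_sub_word (a' := a') hS hSinv hSG hSGinv hRSU hpos'U x,
    sub_sub_sub_cancel_left, norm_sub_rev]
  subst hσ
  exact norm_Pk_sub_Pk_le (covDerivL2K ℂ c₀ ((η : ℂ))⁻¹ (adTransportW φ U)) (covDerivL2K ℂ c₀ ((η : ℂ))⁻¹ (adTransportW φ V))
    (((WL2.linearEquiv ℂ ℂ (fun _ : TSite d m => c₁)).symm.toLinearMap ∘ₗ QprimeTowerW L m n φ U (c₀ := c₀) :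
      SiteL2K ℂ d (towerP L m (n + 1)) c₀ W →ₗ[ℂ] SiteL2K ℂ d m c₁ W))
    (((WL2.linearEquiv ℂ ℂ (fun _ : TSite d m => c₁)).symm.toLinearMap ∘ₗ QprimeTowerW L m n φ V (c₀ := c₀) :
      SiteL2K ℂ d (towerP L m (n + 1)) c₀ W →ₗ[ℂ] SiteL2K ℂ d m c₁ W))
    a' γ M β _ _ _ _ _ _ _ _ _ _ _ _ _ _ ha' hγ hγ1 hM hβ hβ1 coerciveU coerciveV hMQU hMQV dDU dDU' dQU dQU' dDV dDV' dQV dQV' small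
    hHkU hHkGkU hHkV hHkGkV hGkHkV hbD0 hbD0 hbQ0 hbQ0 tD tD' tQ tQ' hckU hkcV (by positivity : (0 : ℝ) ≤ 2 / κ₁) nckU nckV x

end Letters

/-! ## §2 In the `exp(κ•M)` currency of I-5 ∕ I-7's displayed binder `hTR` -/

section ExpCurrency

variable {d : ℕ} {L : ℕ} [NeZero L] {m : Fin d → ℕ} [∀ i, NeZero (m i)] {n : ℕ}
  {𝔸 : Type*} [NormedRing 𝔸] [NormedAlgebra ℂ 𝔸] [CompleteSpace 𝔸] [NormOneClass 𝔸]
  {W : Type*} [NormedAddCommGroup W] [InnerProductSpace ℂ W] [FiniteDimensional ℂ W] {φ : W ≃ₗ[ℂ] 𝔸} {Mφ Mφ' : ℝ}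
  (hφ : ∀ w, ‖φ w‖ ≤ Mφ * ‖w‖) (hφ' : ∀ X, ‖φ.symm X‖ ≤ Mφ' * ‖X‖) (hMφ : 0 ≤ Mφ) (hMφ' : 0 ≤ Mφ')
  {c₀ : ℝ} [Fact (0 < c₀)] {η : ℝ} (hη : 0 < η) {U V : Bond d (towerP L m (n + 1)) → 𝔸ˣ} (hU : ∀ b, U b ∈ U1 𝔸) (hV : ∀ b, V b ∈ U1 𝔸)
  {c₁ : ℝ} [Fact (0 < c₁)] {a' : ℝ} (ha' : 0 ≤ a')
  (hRSU : ∀ (b : Bond d (towerP L m (n + 1))) (v u : W), ⟪adTransportW φ U b v, u⟫_ℂ = ⟪v, adTransportW φ (fun b => (U b)⁻¹) b u⟫_ℂ)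
  (hRSV : ∀ (b : Bond d (towerP L m (n + 1))) (v u : W), ⟪adTransportW φ V b v, u⟫_ℂ = ⟪v, adTransportW φ (fun b => (V b)⁻¹) b u⟫_ℂ)
  (hpos'U : ∀ x : SiteL2K ℂ d (towerP L m (n + 1)) c₀ W, x ≠ 0 → 0 < RCLike.re ⟪x, laplacePrimeAk L m n φ η U a' (c₁ := c₁) x⟫_ℂ)
  (hpos'V : ∀ x : SiteL2K ℂ d (towerP L m (n + 1)) c₀ W, x ≠ 0 → 0 < RCLike.re ⟪x, laplacePrimeAk L m n φ η V a' (c₁ := c₁) x⟫_ℂ)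
  {ℓ ℓ' : ℝ} (hℓ : 0 ≤ ℓ) (hℓ' : 0 ≤ ℓ')
  {δ : ℝ} (hδ : 0 ≤ δ) (hUV : ∀ b, ‖(U b : 𝔸) - (V b : 𝔸)‖ ≤ δ * η)
  (εU δUV : ℕ → ℝ) (hεU : ∀ j, 0 ≤ εU j) (hδUV : ∀ j, 0 ≤ δUV j)
  (hLεU : ∀ (j : ℕ) (b : Bond d (towerP L m (j + 1))), ‖(UlevOf L m (n + 1) U j b : 𝔸) - 1‖ ≤ εU j)
  (hLεV : ∀ (j : ℕ) (b : Bond d (towerP L m (j + 1))), ‖(UlevOf L m (n + 1) V j b : 𝔸) - 1‖ ≤ εU j)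
  (hLbU : ∀ (j : ℕ) (b : Bond d (towerP L m (j + 1))), UlevOf L m (n + 1) U j b ∈ U1 𝔸)
  (hLbV : ∀ (j : ℕ) (b : Bond d (towerP L m (j + 1))), UlevOf L m (n + 1) V j b ∈ U1 𝔸)
  (hLUV : ∀ (j : ℕ) (b : Bond d (towerP L m (j + 1))), ‖(UlevOf L m (n + 1) U j b : 𝔸) - (UlevOf L m (n + 1) V j b : 𝔸)‖ ≤ δUV j)

include hφ hφ' hMφ hMφ' hη hU hV ha' hRSU hRSV hℓ hℓ' hδ hUV hεU hδUV hLεU hLεV hLbU hLbV hLUV in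
/-- **`δ_R` IN THE `hTR` SHAPE OF THE N52 ROAD (α) END** (I-5 `B9Eq326DeltaABlockDecayTowerTwoBackgroundsCurvQ` ∕ I-7 `…Closed`): for every fine weight `χ`
(increments `≤ ℓη`), one-big-block companion `χ′` (`≤ ℓ′`), multipliers `M_B, M_S, M_F` acting as `χ(b₋)·`, `χ·`, `χ′(b′₋)·` and `‖κ‖ = r`:
`‖e^{κM_S}(R_k(V)(e^{−κM_S}s)) − e^{κM_S}(R_k(U)(e^{−κM_S}s))‖ ≤ ρ₂(r)·‖s‖` — §1 with `S := exp(κ•M_S)`, `S_B := exp(κ•M_B)` (`B9Eq3101ExpPointwiseMultiplier`) and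
the coarse-site multiplier by `χ′` built inside the proof. [folklore] [cite: Balaban1985BackgroundPropagators, (3.21) p.394, (3.25) p.394, (3.49) p.399, Thm 3.11 p.416] -/
theorem norm_expConj_RofUk_sub_expConj_RofUk_le {γ κ₁ M β r : ℝ} (hγ : 0 < γ) (hγ1 : γ ≤ 1) (hκ₁ : 0 < κ₁) (hM : 0 ≤ M) (hβ : 0 ≤ β)
    (hβ1 : β ≤ 1)
    (coerciveU : ∀ f : SiteL2K ℂ d (towerP L m (n + 1)) c₀ W, γ * ‖f‖ ^ 2 ≤ ‖(covDerivL2K ℂ c₀ ((η : ℂ))⁻¹ (adTransportW φ U)) f‖ ^ 2 +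
      a' * ‖((WL2.linearEquiv ℂ ℂ (fun _ : TSite d m => c₁)).symm.toLinearMap ∘ₗ QprimeTowerW L m n φ U (c₀ := c₀)) f‖ ^ 2)
    (coerciveV : ∀ f : SiteL2K ℂ d (towerP L m (n + 1)) c₀ W, γ * ‖f‖ ^ 2 ≤ ‖(covDerivL2K ℂ c₀ ((η : ℂ))⁻¹ (adTransportW φ V)) f‖ ^ 2 +
      a' * ‖((WL2.linearEquiv ℂ ℂ (fun _ : TSite d m => c₁)).symm.toLinearMap ∘ₗ QprimeTowerW L m n φ V (c₀ := c₀)) f‖ ^ 2)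
    (hκU : ∀ ψ : SiteL2K ℂ d m c₁ W, κ₁ * ‖ψ‖ ^ 2 ≤ RCLike.re ⟪ψ,
      (((WL2.linearEquiv ℂ ℂ (fun _ : TSite d m => c₁)).symm.toLinearMap ∘ₗ QprimeTowerW L m n φ U (c₀ := c₀)) ∘ₗ
        GpOfUk L m n φ η U a' (c₁ := c₁) hpos'U ∘ₗ GpOfUk L m n φ η U a' (c₁ := c₁) hpos'U ∘ₗ
        LinearMap.adjoint ((WL2.linearEquiv ℂ ℂ (fun _ : TSite d m => c₁)).symm.toLinearMap ∘ₗ QprimeTowerW L m n φ U (c₀ := c₀))) ψ⟫_ℂ)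
    (hκV : ∀ ψ : SiteL2K ℂ d m c₁ W, κ₁ * ‖ψ‖ ^ 2 ≤ RCLike.re ⟪ψ,
      (((WL2.linearEquiv ℂ ℂ (fun _ : TSite d m => c₁)).symm.toLinearMap ∘ₗ QprimeTowerW L m n φ V (c₀ := c₀)) ∘ₗ
        GpOfUk L m n φ η V a' (c₁ := c₁) hpos'V ∘ₗ GpOfUk L m n φ η V a' (c₁ := c₁) hpos'V ∘ₗ
        LinearMap.adjoint ((WL2.linearEquiv ℂ ℂ (fun _ : TSite d m => c₁)).symm.toLinearMap ∘ₗ QprimeTowerW L m n φ V (c₀ := c₀))) ψ⟫_ℂ)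
    (hMQU : ∀ s : SiteL2K ℂ d (towerP L m (n + 1)) c₀ W,
      ‖((WL2.linearEquiv ℂ ℂ (fun _ : TSite d m => c₁)).symm.toLinearMap ∘ₗ QprimeTowerW L m n φ U (c₀ := c₀)) s‖ ≤ M * ‖s‖)
    (hMQV : ∀ s : SiteL2K ℂ d (towerP L m (n + 1)) c₀ W,
      ‖((WL2.linearEquiv ℂ ℂ (fun _ : TSite d m => c₁)).symm.toLinearMap ∘ₗ QprimeTowerW L m n φ V (c₀ := c₀)) s‖ ≤ M * ‖s‖)
    (hwin : r * ℓ * η ≤ 1) (hwin' : r * ℓ' ≤ 1) (hβD : 2 * r * ℓ * (Mφ * Mφ') * Real.sqrt d ≤ β) (hβQ : 2 * r * ℓ' * M ≤ β)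
    (small : 3 * (1 + a') * β ^ 2 ≤ γ / 4)
    (hwinc : β * ((4 / γ + M * ((4 / γ) ^ 2 * (3 + a' * (2 * M + 1)))) * (4 / γ) * (2 * M + 1)) ≤ κ₁ / 2)
    {bD bQ σ : ℝ} (hbD : bD = 2 * Real.exp (r * (ℓ * η)) * (Mφ * Mφ') * Real.sqrt d * δ)
    (hbQ : bQ = Real.exp (r * ℓ') * ((∏ j ∈ Finset.range (n + 1), (1 + 2 * Mφ * Mφ' * εU j) ^ (d * (L - 1))) *
        ((∏ j ∈ Finset.range (n + 1), (1 + (d * (L - 1) : ℕ) * (2 * Mφ * Mφ' * δUV j) * (1 + 2 * Mφ * Mφ' * εU j) ^ (d * (L - 1)))) - 1) *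
        Real.sqrt (c₁ / (c₀ * ((L : ℝ) ^ (n + 1)) ^ d))))
    (hσ : σ = 4 / γ * bQ + bQ * (4 / γ) + 2 * (M + 1) * ((4 / γ) ^ 2 * (2 * bD + (1 + β) * bD + a' * (M + 1) * (bQ + bQ)))) :
    ∀ (χ : TSite d (towerP L m (n + 1)) → ℝ) (χ' : TSite d m → ℝ),
      (∀ b : Bond d (towerP L m (n + 1)), |χ (bpos b) - χ (btgt b)| ≤ ℓ * η) →
      (∀ (y : TSite d m) (x : TSite d (towerP L m (n + 1))),
        siteCast (towerP_eq_fineP_pow L m (n + 1)) x ∈ B9Eq319QprimeTorus.blockOf (L ^ (n + 1)) m y → |χ' y - χ x| ≤ ℓ') →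
      ∀ (MB : BondL2K ℂ d (towerP L m (n + 1)) c₀ W →L[ℂ] BondL2K ℂ d (towerP L m (n + 1)) c₀ W),
      (∀ (g : BondL2K ℂ d (towerP L m (n + 1)) c₀ W) (b : Bond d (towerP L m (n + 1))),
        WL2.equiv ℂ (fun _ : Bond d (towerP L m (n + 1)) => c₀) W (MB g) b =
          (χ (bpos b) : ℂ) • WL2.equiv ℂ (fun _ : Bond d (towerP L m (n + 1)) => c₀) W g b) →
      ∀ (MS : SiteL2K ℂ d (towerP L m (n + 1)) c₀ W →L[ℂ] SiteL2K ℂ d (towerP L m (n + 1)) c₀ W),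
      (∀ (g : SiteL2K ℂ d (towerP L m (n + 1)) c₀ W) (x : TSite d (towerP L m (n + 1))),
        WL2.equiv ℂ (fun _ : TSite d (towerP L m (n + 1)) => c₀) W (MS g) x =
          (χ x : ℂ) • WL2.equiv ℂ (fun _ : TSite d (towerP L m (n + 1)) => c₀) W g x) →
      ∀ (MF : BondL2K ℂ d m c₁ W →L[ℂ] BondL2K ℂ d m c₁ W),
      (∀ (g : BondL2K ℂ d m c₁ W) (b' : Bond d m),
        WL2.equiv ℂ (fun _ : Bond d m => c₁) W (MF g) b' = (χ' (bpos b') : ℂ) • WL2.equiv ℂ (fun _ : Bond d m => c₁) W g b') →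
      ∀ κ : ℂ, ‖κ‖ = r →
      ∀ s, ‖exp (κ • MS) (RofUk L m n φ η V (c₀ := c₀) (exp (κ • (-MS)) s)) - exp (κ • MS) (RofUk L m n φ η U (c₀ := c₀) (exp (κ • (-MS)) s))‖ ≤
        (σ * (2 / κ₁) * (4 / γ * (M + 1)) +
            4 / γ * (M + 1) * ((2 / κ₁) * (σ * (4 / γ * (M + 1)) + 4 / γ * (M + 1) * σ) * (2 / κ₁)) * (4 / γ * (M + 1)) +
          4 / γ * (M + 1) * (2 / κ₁) * σ) * ‖s‖ := by
  intro χ χ' hχ hχ' MB hMB MS hMS _MF _hMF κ hκr s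
  -- the coarse-site multiplier by `χ′` (no definition minted)
  let MG : SiteL2K ℂ d m c₁ W →L[ℂ] SiteL2K ℂ d m c₁ W := LinearMap.toContinuousLinearMap
    ((WL2.linearEquiv ℂ ℂ (fun _ : TSite d m => c₁)).symm.toLinearMap ∘ₗ
      (LinearMap.pi fun y : TSite d m => ((χ' y : ℝ) : ℂ) • LinearMap.proj y) ∘ₗ (WL2.linearEquiv ℂ ℂ (fun _ : TSite d m => c₁)).toLinearMap)
  have hMG : ∀ (g : SiteL2K ℂ d m c₁ W) (y : TSite d m),
      WL2.equiv ℂ (fun _ : TSite d m => c₁) W (MG g) y = (χ' y : ℂ) • WL2.equiv ℂ (fun _ : TSite d m => c₁) W g y := fun g y => rfl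
  have hwin1 : ‖κ‖ * ℓ * η ≤ 1 := by rw [hκr]; exact hwin
  have hwin2 : ‖κ‖ * ℓ' ≤ 1 := by rw [hκr]; exact hwin'
  have hβD' : 2 * ‖κ‖ * ℓ * (Mφ * Mφ') * Real.sqrt d ≤ β := by rw [hκr]; exact hβD
  have hβQ' : 2 * ‖κ‖ * ℓ' * M ≤ β := by rw [hκr]; exact hβQ
  have hχ'' : ∀ (y : TSite d m) (x : TSite d (towerP L m (n + 1))),
      blockCoord (L ^ (n + 1)) m (siteCast (towerP_eq_fineP_pow L m (n + 1)) x) = y → |χ' y - χ x| ≤ ℓ' :=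
    fun y x hxy => hχ' y x ((mem_blockOf_iff (L ^ (n + 1)) m y _).mpr hxy)
  have h := norm_conjRofUk_sub_conjRofUk_le (L := L) (m := m) (n := n) hφ hφ' hMφ hMφ' hη hU hV ha' hRSU hRSV hpos'U hpos'V hℓ hℓ' hχ hχ''
    hwin1 hwin2
    (S := ((exp (κ • MS) : SiteL2K ℂ d (towerP L m (n + 1)) c₀ W →L[ℂ] SiteL2K ℂ d (towerP L m (n + 1)) c₀ W) :
      SiteL2K ℂ d (towerP L m (n + 1)) c₀ W →ₗ[ℂ] SiteL2K ℂ d (towerP L m (n + 1)) c₀ W))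
    (Sinv := ((exp (κ • (-MS)) : SiteL2K ℂ d (towerP L m (n + 1)) c₀ W →L[ℂ] SiteL2K ℂ d (towerP L m (n + 1)) c₀ W) :
      SiteL2K ℂ d (towerP L m (n + 1)) c₀ W →ₗ[ℂ] SiteL2K ℂ d (towerP L m (n + 1)) c₀ W))
    (fun f x => equiv_exp_smul_apply_complex MS χ hMS κ f x) (fun f x => equiv_exp_smul_neg_apply_complex MS χ hMS κ f x)
    (SB := ((exp (κ • MB) : BondL2K ℂ d (towerP L m (n + 1)) c₀ W →L[ℂ] BondL2K ℂ d (towerP L m (n + 1)) c₀ W) :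
      BondL2K ℂ d (towerP L m (n + 1)) c₀ W →ₗ[ℂ] BondL2K ℂ d (towerP L m (n + 1)) c₀ W))
    (SBinv := ((exp (κ • (-MB)) : BondL2K ℂ d (towerP L m (n + 1)) c₀ W →L[ℂ] BondL2K ℂ d (towerP L m (n + 1)) c₀ W) :
      BondL2K ℂ d (towerP L m (n + 1)) c₀ W →ₗ[ℂ] BondL2K ℂ d (towerP L m (n + 1)) c₀ W))
    (fun g b => equiv_exp_smul_apply_complex MB (fun b => χ (bpos b)) hMB κ g b)
    (fun g b => equiv_exp_smul_neg_apply_complex MB (fun b => χ (bpos b)) hMB κ g b)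
    (SG := ((exp (κ • MG) : SiteL2K ℂ d m c₁ W →L[ℂ] SiteL2K ℂ d m c₁ W) : SiteL2K ℂ d m c₁ W →ₗ[ℂ] SiteL2K ℂ d m c₁ W))
    (SGinv := ((exp (κ • (-MG)) : SiteL2K ℂ d m c₁ W →L[ℂ] SiteL2K ℂ d m c₁ W) : SiteL2K ℂ d m c₁ W →ₗ[ℂ] SiteL2K ℂ d m c₁ W))
    (fun g y => equiv_exp_smul_apply_complex MG (fun y => χ' y) hMG κ g y)
    (fun g y => equiv_exp_smul_neg_apply_complex MG (fun y => χ' y) hMG κ g y)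
    hδ hUV εU δUV hεU hδUV hLεU hLεV hLbU hLbV hLUV hγ hγ1 hκ₁ hM hβ hβ1 coerciveU coerciveV hκU hκV hMQU hMQV hβD' hβQ' small hwinc
    (bD := bD) (bQ := bQ) (σ := σ) (by rw [hκr]; exact hbD) (by rw [hκr]; exact hbQ) hσ s
  simp only [ContinuousLinearMap.coe_coe] at h
  exact h

end ExpCurrency

end Literature.MathematicalPhysics.QuantumFieldTheory.Balaban1983to89.B9Eq349ConjugatedProjectionDifferenceTowerTwoBackgrounds

end
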